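import Summits.HodgeConjecture.HodgeConjecture.Theorems.F0P3SpectralPacketXiHSigned          -- ★ (N) FILE 3r p843864 (this seat): `XiHPacketsSigned`, `rhoXiS` (+ ★ 3q `XiPacketsSigned`, `piXiS`; ★ 3f `transportAPackets`, `evpGψ`; ★ 3h `evpHψ`, `evpAtψ`; ★ 3g `imageG`, `ramFinsetH`)
import Summits.HodgeConjecture.HodgeConjecture.Theorems.F0P3SpectralPacketAnchors           -- ★ (N) FILE 3i p843028: `GlobalPacket.evpAtψ_of_test` (+ ★ `F0P3EigencharacterTransport.eigencharacter_comap_of_map_eq`, ★ 2b `evpAt_of_unr_eq_eigencharacter`, `ramFinset`)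
import Summits.HodgeConjecture.HodgeConjecture.Theorems.F0P3GlobalPacketOfAPackets          -- ★ (N) FILE 3b p841519: (ℓ9) `UnrDefLaw`
import HarnessLib

/-!
# (N) DEFS, FILE 3s — (P2a) AT THE TUPLE: THE RAMIFICATION AND THE e.v.p. OF `Π(ξ)` AND OF `ξ_H(ξ)` AGREE WITH THE ξ-RECORD OFF `S ⊇ S₀ ∪ ram ξ`
# (Rogawski §13.3 p. 199 ¶2, p. 203 l. 1–3; §13.7 p. 206 «`t(Π(ξ))`»; §12.2 p. 174 l. 1; §13.1 Prop. 13.1.3 (d) p. 199; §14.2 p. 232)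

Cell `hodgecm-mathlib` (D-0151), F0∕P3 «U3-mult», crux H413 (`stmt-HodgeConjecture-24833`), route of record `HCCMUnconditional`.  (N) lead pen F0P3a-p01 (g13); BOARD rev. 4
`F0/P3a/F0P3a-p01/g13/BOARD-N-DEFS-handoff.F0P3a-p01g13.md` eb9b3ecc §B3′ «(P2) = (P2a) read-backs + (P2b) germ-sum laws»; LEAD F0P3a-plan (g10).  PROOF LANE: theorems only (0 definitions,
no instance, no notation, no named fact, no `sorry`); `--supports stmt-HodgeConjecture-24833 --as helper`.
HONEST LABEL: HC_CM is proved only modulo the printed citations until rung 0 closes; this file proves no printed statement — it discharges the four «consistency» conjuncts of (P2)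
`APacketSpectral` (`ramG (PiXi ξ) ⊆ S`, `ramH (ρXi ξ) ⊆ S`, `EqOff S (evpG (PiXi ξ)) (tXi ξ)`, `EqOff S (evpH (ρXi ξ)) (tXi ξ)`) AT THE (N) TUPLE from kit laws + the signed shapes + ONE record
fact («`πⁿ(ξ_v)` of the record is `K′_v`-spherical off `ram ξ`», the defining property of ★ `ramOfRecord₂`), leaving the two GERM SUMS of (P2) (Thm. 13.3.5 rigidity, Thm. 13.3.7
multiplicities) to FILE 3t as named laws.

THE MATHEMATICS.  Off `ram ξ` the record's `πⁿ(ξ_v)` is `K′_v`-spherical [§12.2 p. 174 l. 1: `πⁿ(ξ_v)` is the unramified constituent]; transported along `ψ_v` (with `ψ_v(K′_v) = K_v` off `S₀`,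
pin (ix′)) it is a `K_v`-spherical MEMBER of `Π(ξ)_v` (signed shape ★ 3q) resp. of `ξ_H(ξ_v)` (signed `H`-shape ★ 3r), so by (ℓ9) `UnrDefLaw` the packet is unramified (`v ∉ ramG`,
`v ∉ ramH`) and by (ℓ4) `UnramLaw` that member IS `sph`; the tuple's e.v.p. slot (★ 3f `evpGψ` ∕ ★ 3h `evpHψ` = the normalised eigencharacter of `sph` read on `G′_v` through `ψ_v`) is then
the eigencharacter of `πⁿ(ξ_v)` on `G′_v` (★ `eigencharacter_comap_of_map_eq`) — which is ★ `xiEvpOfRecordSCD`'s BODY `tXi ξ v := (packFin ξ v).πn.eigencharacter K′_v (νG v)` [§13.7 p. 206].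

CONTENTS.
* §1 (s0) `GlobalPacket.unr_of_spherical_mem`, **`GlobalPacket.evpAtψ_eq_eigencharacter_of_mem`** — generic core: a `K′_v`-spherical `G′_v`-class whose `ψ_v`-transport is a member pins
  `unr` and the e.v.p. slot.
* §2 (s1) `SpectralPacketG.not_mem_ramFinset_piXiS`, **`ramFinset_piXiS_subset`**, (s2) **`evpGψ_piXiS_eq_of_not_mem`** — (P2a)-G at `PiXi := piXiS hXiS`.
* §3 (s3) `SpectralPacketH.not_mem_ramFinsetH_rhoXiS`, **`ramFinsetH_rhoXiS_subset`**, (s4) **`evpHψ_rhoXiS_eq_of_not_mem`** — (P2a)-H at `ρXi := rhoXiS hXiHS`.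

References: [Rogawski1990] §13.3 p. 199 ¶2, p. 201 ¶2, p. 203 l. 1–3; §13.7 p. 206; §12.2 p. 174 l. 1; §13.1 Prop. 13.1.3 (d) p. 199; §14.2 p. 232; §4.5 p. 45.  [CartierCorvallis1979] §IV.1 Cor. 4.1.
-/

set_option autoImplicit false
-- the mandated namespace repeats `HodgeConjecture.HodgeConjecture`, as in every `Theorems/*.lean` of this sub-problem
set_option linter.dupNamespace false

noncomputable section

open NumberField IsDedekindDomain MeasureTheory Filter
open scoped Matrix MatrixGroups

open Literature.NumberTheory Literature.NumberTheory.Automorphic Literature.NumberTheory.Automorphic.UnitaryGroup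
open Literature.NumberTheory.Rogawski1990 Literature.NumberTheory.GaloisRepresentations
open Literature.RepresentationTheory.BorelWallach2000 Literature.RepresentationTheory.KonnoKonno2007
open Summit.HodgeConjecture.HodgeConjecture.Cruxes.H413.F0P3InnerFormClassificationV6 (TestG splitForm)
open Summit.HodgeConjecture.HodgeConjecture.Cruxes.H413.F0P3LocalPacketKit
open Summit.HodgeConjecture.HodgeConjecture.Cruxes.H413.F0P3ArchPacketKit
open Summit.HodgeConjecture.HodgeConjecture.Cruxes.H413.F0P3EigencharacterTransport (eigencharacter_comap_of_map_eq)

/-! ## §1 (s0) Generic core: a spherical record class whose transport is a member [p. 201 ¶2; p. 203 l. 1–3; §13.7 p. 206] -/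

namespace Summit.HodgeConjecture.HodgeConjecture.Cruxes.H413.F0P3GlobalPacket.GlobalPacket

variable {L : Type} [Field L] [NumberField L] [IsCMField L] {H : Matrix (Fin 3) (Fin 3) L}
  {𝔩 : ∀ v : HeightOneSpectrum (𝓞 ↥(maximalRealSubfield L)), LocalPacketKit L (splitForm L 3) v}

/-- **(s0a)** If the `ψ_v`-transport of a `K′_v`-spherical class `π′` of `G′_v` is a member of `Π_v` and `ψ_v(K′_v) = K_v`, then `Π_v` is unramified ((ℓ9) `UnrDefLaw`).
[cite: Rogawski1990, §13.3 p. 201 ¶2; §4.5 p. 45] -/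
theorem unr_of_spherical_mem (Pg : GlobalPacket 𝔩)
    (ψ : ∀ v : HeightOneSpectrum (𝓞 ↥(maximalRealSubfield L)), (cmDatum L 3 H).Local v ≃ₜ* (cmDatum L 3 (splitForm L 3)).Local v)
    {v : HeightOneSpectrum (𝓞 ↥(maximalRealSubfield L))} (h9 : UnrDefLaw (𝔩 v))
    (hψK : (cmLocalIntegralLevel L 3 H v).map (ψ v : (cmDatum L 3 H).Local v →* (cmDatum L 3 (splitForm L 3)).Local v) = cmLocalIntegralLevel L 3 (splitForm L 3) v)
    {π' : IrrClass ((cmDatum L 3 H).Local v)} (hsph : π'.IsSpherical (cmLocalIntegralLevel L 3 H v))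
    (hmem : IrrClass.comap (ψ v).symm π' ∈ (𝔩 v).mem (Pg.loc v)) : (𝔩 v).unr (Pg.loc v) :=
  (h9 (Pg.loc v)).2 ⟨_, hmem, by rw [← hψK]; exact (IrrClass.isSpherical_comap_symm_map_iff (ψ v) π' _).2 hsph⟩

/-- **(s0b) THE e.v.p. SLOT IS THE EIGENCHARACTER OF THE RECORD CLASS**: under (ℓ4) `UnramLaw`, (ℓ9) `UnrDefLaw`, `ψ_v(K′_v) = K_v`, for an admissible `K′_v`-spherical class `π′` of `G′_v`
whose transport `π′ ∘ ψ_v⁻¹` is a member of `Π_v`: `Π.evpAtψ ψ (ψ_* ν′) v = π′.eigencharacter K′_v (ν′_v)` as functionals on `G′_v → ℂ` (both junk `0` off `C_c(K′_v\G′_v/K′_v)`).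
[cite: Rogawski1990, §13.7 p. 206; §13.3 p. 203 l. 1–3; §14.2 p. 232] [cite: CartierCorvallis1979, §IV.1 Cor. 4.1] -/
theorem evpAtψ_eq_eigencharacter_of_mem (Pg : GlobalPacket 𝔩)
    (ψ : ∀ v : HeightOneSpectrum (𝓞 ↥(maximalRealSubfield L)), (cmDatum L 3 H).Local v ≃ₜ* (cmDatum L 3 (splitForm L 3)).Local v)
    [∀ v : HeightOneSpectrum (𝓞 ↥(maximalRealSubfield L)), MeasurableSpace ((cmDatum L 3 (splitForm L 3)).Local v)]
    [∀ v : HeightOneSpectrum (𝓞 ↥(maximalRealSubfield L)), BorelSpace ((cmDatum L 3 (splitForm L 3)).Local v)]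
    [∀ v : HeightOneSpectrum (𝓞 ↥(maximalRealSubfield L)), MeasurableSpace ((cmDatum L 3 H).Local v)]
    [∀ v : HeightOneSpectrum (𝓞 ↥(maximalRealSubfield L)), BorelSpace ((cmDatum L 3 H).Local v)]
    (νG' : ∀ v : HeightOneSpectrum (𝓞 ↥(maximalRealSubfield L)), Measure ((cmDatum L 3 H).Local v))
    [∀ v, (νG' v).IsMulLeftInvariant] [∀ v, IsFiniteMeasureOnCompacts (νG' v)]
    {v : HeightOneSpectrum (𝓞 ↥(maximalRealSubfield L))} (h4 : (𝔩 v).UnramLaw) (h9 : UnrDefLaw (𝔩 v))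
    (hψK : (cmLocalIntegralLevel L 3 H v).map (ψ v : (cmDatum L 3 H).Local v →* (cmDatum L 3 (splitForm L 3)).Local v) = cmLocalIntegralLevel L 3 (splitForm L 3) v)
    {π' : IrrClass ((cmDatum L 3 H).Local v)} (hadm : π'.IsAdmissible) (hsph : π'.IsSpherical (cmLocalIntegralLevel L 3 H v))
    (hmem : IrrClass.comap (ψ v).symm π' ∈ (𝔩 v).mem (Pg.loc v)) :
    Pg.evpAtψ ψ (fun w => (νG' w).map (ψ w)) v = π'.eigencharacter (cmLocalIntegralLevel L 3 H v) (νG' v) := by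
  have hunr : (𝔩 v).unr (Pg.loc v) := Pg.unr_of_spherical_mem ψ h9 hψK hsph hmem
  -- the transport is `K_v`-spherical, hence IS the unramified member `sph` ((ℓ4) uniqueness)
  have hsphK : (IrrClass.comap (ψ v).symm π').IsSpherical (cmLocalIntegralLevel L 3 (splitForm L 3) v) := by
    rw [← hψK]; exact (IrrClass.isSpherical_comap_symm_map_iff (ψ v) π' _).2 hsph
  have hsph_eq : IrrClass.comap (ψ v).symm π' = (𝔩 v).sph (Pg.loc v) hunr := (h4 (Pg.loc v) hunr).2.2.1 _ hmem hsphK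
  funext f
  by_cases hf : HasCompactSupport f ∧ IsLevel (cmLocalIntegralLevel L 3 H v) f
  · rw [Pg.evpAtψ_of_test ψ _ hf, Pg.evpAt_of_unr_eq_eigencharacter v _ hunr, ← hsph_eq]
    -- read the transported class back on `G′_v`: `π′ = (π′ ∘ ψ_v⁻¹) ∘ ψ_v`
    have key := eigencharacter_comap_of_map_eq (ψ v) (hadm.comap (ψ v).symm) hψK (νG' v) f
    rw [IrrClass.comap_comap_symm] at key
    exact key.symm
  · rw [Pg.evpAtψ_of_not hf, IrrClass.eigencharacter_of_not _ _ _ hf]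

end Summit.HodgeConjecture.HodgeConjecture.Cruxes.H413.F0P3GlobalPacket.GlobalPacket

/-! ## §2 (s1)–(s2) (P2a)-G at `PiXi := piXiS hXiS` [p. 199 ¶2; §13.7 p. 206; §12.2 p. 174 l. 1] -/

namespace Summit.HodgeConjecture.HodgeConjecture.Cruxes.H413.F0P3SpectralPacket.SpectralPacketG

open Summit.HodgeConjecture.HodgeConjecture.Cruxes.H413.F0P3GlobalPacket

variable {L : Type} [Field L] [NumberField L] [IsCMField L] {H : Matrix (Fin 3) (Fin 3) L}
  {𝔩 : ∀ v : HeightOneSpectrum (𝓞 ↥(maximalRealSubfield L)), LocalPacketKit L (splitForm L 3) v} {𝔞 : ArchPacketKit}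
  {μ : Measure (adelicGroupData (↥(maximalRealSubfield L)) L (IsCMField.complexConj L) 3 (splitForm L 3)).automorphicQuotient}
  [SMulInvariantMeasure (adelicGroupData (↥(maximalRealSubfield L)) L (IsCMField.complexConj L) 3 (splitForm L 3)).Adelic
    (adelicGroupData (↥(maximalRealSubfield L)) L (IsCMField.complexConj L) 3 (splitForm L 3)).automorphicQuotient μ]
  {Pk' : OneDimAutRepH L → ∀ v : HeightOneSpectrum (𝓞 ↥(maximalRealSubfield L)), CMLocalAPacket L H v}
  {PkInf : OneDimAutRepH L → LocalAPacket (GKIrrClass (uFormGroup (Fin 2) (Fin 1)))} {κ : OneDimAutRepH L → ℤ}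
  {ram : OneDimAutRepH L → Finset (HeightOneSpectrum (𝓞 ↥(maximalRealSubfield L)))}

/-- **(s1) `v ∉ ramG (Π(ξ))` off `S₀ ∪ ram ξ`**: the record's `πⁿ(ξ_v)` is a `K′_v`-spherical member there, so `Π(ξ)_v` is unramified ((ℓ9)).
[cite: Rogawski1990, §13.3 p. 199 ¶2, p. 201 ¶2; §12.2 p. 174 l. 1] -/
theorem not_mem_ramFinset_piXiS
    (ψ : ∀ v : HeightOneSpectrum (𝓞 ↥(maximalRealSubfield L)), (cmDatum L 3 H).Local v ≃ₜ* (cmDatum L 3 (splitForm L 3)).Local v)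
    (h : XiPacketsSigned 𝔩 𝔞 μ (transportAPackets ψ Pk') PkInf κ) (h9 : ∀ v : HeightOneSpectrum (𝓞 ↥(maximalRealSubfield L)), UnrDefLaw (𝔩 v))
    (S₀ : Finset (HeightOneSpectrum (𝓞 ↥(maximalRealSubfield L))))
    (hψK : ∀ v ∉ S₀, (cmLocalIntegralLevel L 3 H v).map (ψ v : (cmDatum L 3 H).Local v →* (cmDatum L 3 (splitForm L 3)).Local v) =
      cmLocalIntegralLevel L 3 (splitForm L 3) v)
    (hsph : ∀ (ξ : OneDimAutRepH L), ∀ v ∉ ram ξ, (Pk' ξ v).πn.IsSpherical (cmLocalIntegralLevel L 3 H v))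
    (ξ : OneDimAutRepH L) {v : HeightOneSpectrum (𝓞 ↥(maximalRealSubfield L))} (hv₀ : v ∉ S₀) (hv : v ∉ ram ξ) :
    v ∉ (piXiS h ξ).fin.ramFinset := by
  rw [GlobalPacket.mem_ramFinset_iff, not_not]
  exact (piXiS h ξ).fin.unr_of_spherical_mem ψ (h9 v) (hψK v hv₀) (hsph ξ v hv)
    (((mem_piXiS_fin_iff h ξ v _).2 (Or.inl rfl)))

/-- **(P2a)-G, RAMIFICATION: `ramG (PiXi ξ) ⊆ S` for `S ⊇ S₀ ∪ ram ξ`.** [cite: Rogawski1990, §13.3 p. 199 ¶2; §12.2 p. 174 l. 1] -/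
theorem ramFinset_piXiS_subset
    (ψ : ∀ v : HeightOneSpectrum (𝓞 ↥(maximalRealSubfield L)), (cmDatum L 3 H).Local v ≃ₜ* (cmDatum L 3 (splitForm L 3)).Local v)
    (h : XiPacketsSigned 𝔩 𝔞 μ (transportAPackets ψ Pk') PkInf κ) (h9 : ∀ v : HeightOneSpectrum (𝓞 ↥(maximalRealSubfield L)), UnrDefLaw (𝔩 v))
    (S₀ : Finset (HeightOneSpectrum (𝓞 ↥(maximalRealSubfield L))))
    (hψK : ∀ v ∉ S₀, (cmLocalIntegralLevel L 3 H v).map (ψ v : (cmDatum L 3 H).Local v →* (cmDatum L 3 (splitForm L 3)).Local v) =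
      cmLocalIntegralLevel L 3 (splitForm L 3) v)
    (hsph : ∀ (ξ : OneDimAutRepH L), ∀ v ∉ ram ξ, (Pk' ξ v).πn.IsSpherical (cmLocalIntegralLevel L 3 H v))
    (ξ : OneDimAutRepH L) (S : Finset (HeightOneSpectrum (𝓞 ↥(maximalRealSubfield L)))) (hS₀ : S₀ ⊆ S) (hram : ram ξ ⊆ S) :
    (piXiS h ξ).fin.ramFinset ⊆ S := by
  intro v hv
  by_contra hvS
  exact not_mem_ramFinset_piXiS ψ h h9 S₀ hψK hsph ξ (fun h₀ => hvS (hS₀ h₀)) (fun hr => hvS (hram hr)) hv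

variable [∀ v : HeightOneSpectrum (𝓞 ↥(maximalRealSubfield L)), MeasurableSpace ((cmDatum L 3 (splitForm L 3)).Local v)]
  [∀ v : HeightOneSpectrum (𝓞 ↥(maximalRealSubfield L)), BorelSpace ((cmDatum L 3 (splitForm L 3)).Local v)]
  [∀ v : HeightOneSpectrum (𝓞 ↥(maximalRealSubfield L)), MeasurableSpace ((cmDatum L 3 H).Local v)]
  [∀ v : HeightOneSpectrum (𝓞 ↥(maximalRealSubfield L)), BorelSpace ((cmDatum L 3 H).Local v)]
  {νG' : ∀ v : HeightOneSpectrum (𝓞 ↥(maximalRealSubfield L)), Measure ((cmDatum L 3 H).Local v)}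
  [∀ v, (νG' v).IsMulLeftInvariant] [∀ v, IsFiniteMeasureOnCompacts (νG' v)]

/-- **(s2) (P2a)-G, e.v.p.: `evpG (PiXi ξ) v = tXi ξ v` off `S₀ ∪ ram ξ`** — the tuple's slot `(piXiS h ξ).evpGψ ψ (ψ_* ν′) v` IS the record's `t(ξ)_v := πⁿ(ξ_v).eigencharacter K′_v ν′_v`
(★ `xiEvpOfRecordSCD`'s body), modulo (ℓ4), (ℓ9), `ψ_v(K′_v) = K_v`, sphericity and admissibility of the record's `πⁿ(ξ_v)`.
[cite: Rogawski1990, §13.7 p. 206; §12.2 p. 174 l. 1; §13.3 p. 203 l. 1–3] [cite: CartierCorvallis1979, §IV.1 Cor. 4.1] -/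
theorem evpGψ_piXiS_eq_of_not_mem
    (ψ : ∀ v : HeightOneSpectrum (𝓞 ↥(maximalRealSubfield L)), (cmDatum L 3 H).Local v ≃ₜ* (cmDatum L 3 (splitForm L 3)).Local v)
    (h : XiPacketsSigned 𝔩 𝔞 μ (transportAPackets ψ Pk') PkInf κ)
    (h4 : ∀ v : HeightOneSpectrum (𝓞 ↥(maximalRealSubfield L)), (𝔩 v).UnramLaw) (h9 : ∀ v : HeightOneSpectrum (𝓞 ↥(maximalRealSubfield L)), UnrDefLaw (𝔩 v))
    (S₀ : Finset (HeightOneSpectrum (𝓞 ↥(maximalRealSubfield L))))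
    (hψK : ∀ v ∉ S₀, (cmLocalIntegralLevel L 3 H v).map (ψ v : (cmDatum L 3 H).Local v →* (cmDatum L 3 (splitForm L 3)).Local v) =
      cmLocalIntegralLevel L 3 (splitForm L 3) v)
    (hsph : ∀ (ξ : OneDimAutRepH L), ∀ v ∉ ram ξ, (Pk' ξ v).πn.IsSpherical (cmLocalIntegralLevel L 3 H v))
    (hadm : ∀ (ξ : OneDimAutRepH L) (v : HeightOneSpectrum (𝓞 ↥(maximalRealSubfield L))), (Pk' ξ v).πn.IsAdmissible)
    (ξ : OneDimAutRepH L) {v : HeightOneSpectrum (𝓞 ↥(maximalRealSubfield L))} (hv₀ : v ∉ S₀) (hv : v ∉ ram ξ) :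
    (piXiS h ξ).evpGψ ψ (fun w => (νG' w).map (ψ w)) v = (Pk' ξ v).πn.eigencharacter (cmLocalIntegralLevel L 3 H v) (νG' v) := by
  rw [evpGψ_eq_evpAtψ]
  exact (piXiS h ξ).fin.evpAtψ_eq_eigencharacter_of_mem ψ νG' (h4 v) (h9 v) (hψK v hv₀) (hadm ξ v) (hsph ξ v hv)
    (((mem_piXiS_fin_iff h ξ v _).2 (Or.inl rfl)))

end Summit.HodgeConjecture.HodgeConjecture.Cruxes.H413.F0P3SpectralPacket.SpectralPacketG

/-! ## §3 (s3)–(s4) (P2a)-H at `ρXi := rhoXiS hXiHS` [Prop. 13.1.3 (d); p. 199 ¶2; §13.7 p. 206 «`t(Π(ρ)) = ξ_H(t(ρ))`»] -/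

namespace Summit.HodgeConjecture.HodgeConjecture.Cruxes.H413.F0P3SpectralPacket.SpectralPacketH

open Summit.HodgeConjecture.HodgeConjecture.Cruxes.H413.F0P3GlobalPacket

variable {L : Type} [Field L] [NumberField L] [IsCMField L] {H : Matrix (Fin 3) (Fin 3) L}
  {𝔩 : ∀ v : HeightOneSpectrum (𝓞 ↥(maximalRealSubfield L)), LocalPacketKit L (splitForm L 3) v} {𝔞 : ArchPacketKit} {𝔞H : ArchPacketKitH 𝔞}
  {DiscH : GlobalPacketH 𝔩 → 𝔞H.PktInfH → Prop}
  {Pk' : OneDimAutRepH L → ∀ v : HeightOneSpectrum (𝓞 ↥(maximalRealSubfield L)), CMLocalAPacket L H v}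
  {PkInf : OneDimAutRepH L → LocalAPacket (GKIrrClass (uFormGroup (Fin 2) (Fin 1)))}
  {χ : OneDimAutRepH L → ∀ v : HeightOneSpectrum (𝓞 ↥(maximalRealSubfield L)),
    (UnitaryGroup.cmDatum L 2 (Matrix.of fun i j : Fin 2 => if i.val + j.val + 1 = 2 then (1 : L) else 0)).Local v ×
      (UnitaryGroup.cmDatum L 1 (Matrix.of fun i j : Fin 1 => if i.val + j.val + 1 = 1 then (1 : L) else 0)).Local v →* ℂˣ}
  {hχ : ∀ (ξ : OneDimAutRepH L) (v : HeightOneSpectrum (𝓞 ↥(maximalRealSubfield L))),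
    IsOpen (((χ ξ v).ker : Subgroup ((UnitaryGroup.cmDatum L 2 (Matrix.of fun i j : Fin 2 => if i.val + j.val + 1 = 2 then (1 : L) else 0)).Local v ×
      (UnitaryGroup.cmDatum L 1 (Matrix.of fun i j : Fin 1 => if i.val + j.val + 1 = 1 then (1 : L) else 0)).Local v)) :
      Set ((UnitaryGroup.cmDatum L 2 (Matrix.of fun i j : Fin 2 => if i.val + j.val + 1 = 2 then (1 : L) else 0)).Local v ×
        (UnitaryGroup.cmDatum L 1 (Matrix.of fun i j : Fin 1 => if i.val + j.val + 1 = 1 then (1 : L) else 0)).Local v))}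
  {ε : OneDimAutRepH L → HeightOneSpectrum (𝓞 ↥(maximalRealSubfield L)) → ℤ} {κH : OneDimAutRepH L → ℤ}
  {ram : OneDimAutRepH L → Finset (HeightOneSpectrum (𝓞 ↥(maximalRealSubfield L)))}

/-- **(s3) `v ∉ ramH (ξ)` off `S₀ ∪ ram ξ`**: the record's `πⁿ(ξ_v)` is a `K′_v`-spherical member of `ξ_H(ξ_v) = Π(ξ_v)` there, so `ξ_H(ξ_v)` is unramified ((ℓ9)).
[cite: Rogawski1990, §13.1 Prop. 13.1.3 (d) p. 199; §13.3 p. 199 ¶2; §12.2 p. 174 l. 1] -/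
theorem not_mem_ramFinsetH_rhoXiS
    (ψ : ∀ v : HeightOneSpectrum (𝓞 ↥(maximalRealSubfield L)), (cmDatum L 3 H).Local v ≃ₜ* (cmDatum L 3 (splitForm L 3)).Local v)
    (h : XiHPacketsSigned 𝔩 𝔞 𝔞H DiscH (transportAPackets ψ Pk') PkInf χ hχ ε κH) (h9 : ∀ v : HeightOneSpectrum (𝓞 ↥(maximalRealSubfield L)), UnrDefLaw (𝔩 v))
    (S₀ : Finset (HeightOneSpectrum (𝓞 ↥(maximalRealSubfield L))))
    (hψK : ∀ v ∉ S₀, (cmLocalIntegralLevel L 3 H v).map (ψ v : (cmDatum L 3 H).Local v →* (cmDatum L 3 (splitForm L 3)).Local v) =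
      cmLocalIntegralLevel L 3 (splitForm L 3) v)
    (hsph : ∀ (ξ : OneDimAutRepH L), ∀ v ∉ ram ξ, (Pk' ξ v).πn.IsSpherical (cmLocalIntegralLevel L 3 H v))
    (ξ : OneDimAutRepH L) {v : HeightOneSpectrum (𝓞 ↥(maximalRealSubfield L))} (hv₀ : v ∉ S₀) (hv : v ∉ ram ξ) :
    v ∉ (rhoXiS h ξ).ramFinsetH := by
  rw [mem_ramFinsetH_iff, not_not]
  exact (rhoXiS h ξ).imageG.unr_of_spherical_mem ψ (h9 v) (hψK v hv₀) (hsph ξ v hv)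
    (((mem_xiH_rhoXiS_iff h ξ v _).2 (Or.inl rfl)))

/-- **(P2a)-H, RAMIFICATION: `ramH (ρXi ξ) ⊆ S` for `S ⊇ S₀ ∪ ram ξ`.** [cite: Rogawski1990, §13.3 p. 199 ¶2; §13.1 Prop. 13.1.3 (d) p. 199] -/
theorem ramFinsetH_rhoXiS_subset
    (ψ : ∀ v : HeightOneSpectrum (𝓞 ↥(maximalRealSubfield L)), (cmDatum L 3 H).Local v ≃ₜ* (cmDatum L 3 (splitForm L 3)).Local v)
    (h : XiHPacketsSigned 𝔩 𝔞 𝔞H DiscH (transportAPackets ψ Pk') PkInf χ hχ ε κH) (h9 : ∀ v : HeightOneSpectrum (𝓞 ↥(maximalRealSubfield L)), UnrDefLaw (𝔩 v))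
    (S₀ : Finset (HeightOneSpectrum (𝓞 ↥(maximalRealSubfield L))))
    (hψK : ∀ v ∉ S₀, (cmLocalIntegralLevel L 3 H v).map (ψ v : (cmDatum L 3 H).Local v →* (cmDatum L 3 (splitForm L 3)).Local v) =
      cmLocalIntegralLevel L 3 (splitForm L 3) v)
    (hsph : ∀ (ξ : OneDimAutRepH L), ∀ v ∉ ram ξ, (Pk' ξ v).πn.IsSpherical (cmLocalIntegralLevel L 3 H v))
    (ξ : OneDimAutRepH L) (S : Finset (HeightOneSpectrum (𝓞 ↥(maximalRealSubfield L)))) (hS₀ : S₀ ⊆ S) (hram : ram ξ ⊆ S) :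
    (rhoXiS h ξ).ramFinsetH ⊆ S := by
  intro v hv
  by_contra hvS
  exact not_mem_ramFinsetH_rhoXiS ψ h h9 S₀ hψK hsph ξ (fun h₀ => hvS (hS₀ h₀)) (fun hr => hvS (hram hr)) hv

variable [∀ v : HeightOneSpectrum (𝓞 ↥(maximalRealSubfield L)), MeasurableSpace ((cmDatum L 3 (splitForm L 3)).Local v)]
  [∀ v : HeightOneSpectrum (𝓞 ↥(maximalRealSubfield L)), BorelSpace ((cmDatum L 3 (splitForm L 3)).Local v)]
  [∀ v : HeightOneSpectrum (𝓞 ↥(maximalRealSubfield L)), MeasurableSpace ((cmDatum L 3 H).Local v)]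
  [∀ v : HeightOneSpectrum (𝓞 ↥(maximalRealSubfield L)), BorelSpace ((cmDatum L 3 H).Local v)]
  {νG' : ∀ v : HeightOneSpectrum (𝓞 ↥(maximalRealSubfield L)), Measure ((cmDatum L 3 H).Local v)}
  [∀ v, (νG' v).IsMulLeftInvariant] [∀ v, IsFiniteMeasureOnCompacts (νG' v)]

/-- **(s4) (P2a)-H, e.v.p.: `evpH (ρXi ξ) v = tXi ξ v` off `S₀ ∪ ram ξ`** («`t(Π(ρ)) = ξ_H(t(ρ))`», §13.7; here `Π(ξ) = ξ_H(ξ)`): the tuple's slot `(rhoXiS h ξ).evpHψ ψ (ψ_* ν′) v` IS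
the record's `t(ξ)_v`, modulo (ℓ4), (ℓ9), `ψ_v(K′_v) = K_v`, sphericity and admissibility of the record's `πⁿ(ξ_v)`.
[cite: Rogawski1990, §13.7 p. 206; §13.1 Prop. 13.1.3 (d) p. 199; §12.2 p. 174 l. 1] [cite: CartierCorvallis1979, §IV.1 Cor. 4.1] -/
theorem evpHψ_rhoXiS_eq_of_not_mem
    (ψ : ∀ v : HeightOneSpectrum (𝓞 ↥(maximalRealSubfield L)), (cmDatum L 3 H).Local v ≃ₜ* (cmDatum L 3 (splitForm L 3)).Local v)
    (h : XiHPacketsSigned 𝔩 𝔞 𝔞H DiscH (transportAPackets ψ Pk') PkInf χ hχ ε κH)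
    (h4 : ∀ v : HeightOneSpectrum (𝓞 ↥(maximalRealSubfield L)), (𝔩 v).UnramLaw) (h9 : ∀ v : HeightOneSpectrum (𝓞 ↥(maximalRealSubfield L)), UnrDefLaw (𝔩 v))
    (S₀ : Finset (HeightOneSpectrum (𝓞 ↥(maximalRealSubfield L))))
    (hψK : ∀ v ∉ S₀, (cmLocalIntegralLevel L 3 H v).map (ψ v : (cmDatum L 3 H).Local v →* (cmDatum L 3 (splitForm L 3)).Local v) =
      cmLocalIntegralLevel L 3 (splitForm L 3) v)
    (hsph : ∀ (ξ : OneDimAutRepH L), ∀ v ∉ ram ξ, (Pk' ξ v).πn.IsSpherical (cmLocalIntegralLevel L 3 H v))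
    (hadm : ∀ (ξ : OneDimAutRepH L) (v : HeightOneSpectrum (𝓞 ↥(maximalRealSubfield L))), (Pk' ξ v).πn.IsAdmissible)
    (ξ : OneDimAutRepH L) {v : HeightOneSpectrum (𝓞 ↥(maximalRealSubfield L))} (hv₀ : v ∉ S₀) (hv : v ∉ ram ξ) :
    (rhoXiS h ξ).evpHψ ψ (fun w => (νG' w).map (ψ w)) v = (Pk' ξ v).πn.eigencharacter (cmLocalIntegralLevel L 3 H v) (νG' v) := by
  funext f
  change (rhoXiS h ξ).imageG.evpAtψ ψ (fun w => (νG' w).map (ψ w)) v f = _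
  rw [(rhoXiS h ξ).imageG.evpAtψ_eq_eigencharacter_of_mem ψ νG' (h4 v) (h9 v) (hψK v hv₀) (hadm ξ v) (hsph ξ v hv)
    (((mem_xiH_rhoXiS_iff h ξ v _).2 (Or.inl rfl)))]

end Summit.HodgeConjecture.HodgeConjecture.Cruxes.H413.F0P3SpectralPacket.SpectralPacketH

end
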